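import Summits.HubbardSuperconductivity.HubbardSuperconductivity.Theorems.AnisotropyChordTransferFibre3N1RowTrueVecMomenta

/-!
# Route `AnisotropyChord` / H0 rotor rung, LEVEL 2 row `N₁`: object-layer TOOLS at the true vector

Shared tools for the five object theorems (B̂, P̂, Â, Q̂₁, Ĵ₁ ∈ their `RExpr` brackets at `X = xTrue L Δ λ₂ f a`, `a = Δf(x̂)`):
`eval_rsum`, `eval_cube`; the Finset ↔ list bridges `block1_sum_eq` (`Fibre3.block1 L 2` ↦ the list `gridPts 2`),
`block1_subset_erase`, `outer1_sum_eq`; `sum_erase_zero_gres_pow`, `sum_erase_zero_gres`; `S1h_eval` (`S1h ↦ θ²S₁`); and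
★ `kap_eval`: `kap ↦ κ̂′ = κ̂ + 2ac_s/V`, the REPAIRED tail slope of `OuterMaj` (p1 g26 FINDING), realised exactly through the
`ε*`-coordinate (`rho_epsStarR`).
Prover seat `hubbard-h0-rotor-p2` g4; helper for piece A = stmt-HubbardSuperconductivity-23918 of rung 19089
(`--supports`, helper class).  Nothing here proves superconductivity in the Hubbard model; helper lemmas of ONE conditional
reduction (the GM₃ ∀L certificate, Level-2 row `N₁`); the rotor TARGET as originally worded stays FALSE (g15 verdict).
Mathlib + the tree only; no sorry.
-/

set_option linter.dupNamespace false
set_option autoImplicit false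

open Literature.Analysis.ValidatedNumerics

namespace Summit.HubbardSuperconductivity.HubbardSuperconductivity.Theorems.AnisotropyChord.Transfer.Fibre3.L2.N1

variable (L : ℕ) [NeZero L] (Δ lam2 : ℝ) (f : Tor L → ℝ)

/-! ## Generic evaluation helpers -/

/-- value of a list sum term. -/
theorem eval_rsum (x : ℕ → ℝ) : ∀ l : List RExpr, (rsum l).eval x = (l.map (fun e => e.eval x)).sum
  | [] => by simp [rsum, RExpr.eval]
  | [e] => by simp [rsum]
  | e :: e' :: l => by
      rw [show rsum (e :: e' :: l) = .add e (rsum (e' :: l)) from rfl, RExpr.eval, eval_rsum x (e' :: l)]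
      simp

/-- value of a cube. -/
theorem eval_cube (x : ℕ → ℝ) (e : RExpr) : (cube e).eval x = e.eval x ^ 3 := by
  simp only [cube, RExpr.eval]; ring

/-! ## Finset ↔ list bridges for the block -/

/-- the list `gridPts 2` enumerates `(box 2) ∖ {0}` without repetition. -/
theorem gridPts_two_toFinset : (gridPts 2).toFinset = (B1.box 2).erase (0, 0) ∧ (gridPts 2).Nodup := by
  constructor
  · ext q
    rw [List.mem_toFinset, Finset.mem_erase, B1.mem_box_iff]
    constructor
    · intro h; revert q; decide
    · rintro ⟨h0, ⟨h1, h2⟩, ⟨h3, h4⟩⟩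
      have key : ∀ a b : ℤ, -2 ≤ a → a ≤ 2 → -2 ≤ b → b ≤ 2 → (a, b) ≠ (0, 0) → (a, b) ∈ gridPts 2 := by
        intro a b h1 h2 h3 h4
        interval_cases a <;> interval_cases b <;> decide
      exact key q.1 q.2 h1 h2 h3 h4 h0
  · decide

/-- the block points of `M₂ = 2` are grid points of `M = 3`. -/
theorem gridPts_two_sub : ∀ q ∈ gridPts 2, q ∈ gridPts 3 := by decide

/-- ★ a sum over the Finset `block1 L 2` is the list sum over `gridPts 2` (`L ≥ 5`). -/
theorem block1_sum_eq (hL : 5 ≤ L) (φ : Tor L → ℝ) :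
    ∑ k ∈ Fibre3.block1 L 2, φ k = ((gridPts 2).map fun q => φ (B1.toTor L q)).sum := by
  classical
  obtain ⟨hF, hnd⟩ := gridPts_two_toFinset
  unfold Fibre3.block1
  rw [Finset.sum_image]
  · rw [← hF, List.sum_toFinset _ hnd]
  · intro p hp q hq hpq
    have hp' := (Finset.mem_erase.1 hp).2
    have hq' := (Finset.mem_erase.1 hq).2
    have := congrArg (B1.rep L) hpq
    rwa [B1.rep_toTor_of_mem_box L 2 (by omega) p hp', B1.rep_toTor_of_mem_box L 2 (by omega) q hq'] at this

/-- the block avoids the origin (`L ≥ 5`). -/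
theorem block1_subset_erase (hL : 5 ≤ L) : Fibre3.block1 L 2 ⊆ (Finset.univ : Finset (Tor L)).erase 0 := by
  classical
  intro k hk
  unfold Fibre3.block1 at hk
  obtain ⟨p, hp, rfl⟩ := Finset.mem_image.1 hk
  obtain ⟨hp0, hpb⟩ := Finset.mem_erase.1 hp
  refine Finset.mem_erase.2 ⟨?_, Finset.mem_univ _⟩
  have hpW : p ∈ zWindow 2 := by
    rw [B1.mem_zWindow_iff]; exact ⟨hp0, (B1.mem_box_iff 2 p).1 hpb⟩
  have := B1.intCast_ne_zero_of_mem_zWindow L 2 (by omega) p hpW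
  simpa [B1.toTor] using this

/-- ★ a sum over `outer1 L 2` = the sum off the origin minus the block sum (`L ≥ 5`). -/
theorem outer1_sum_eq (hL : 5 ≤ L) (φ : Tor L → ℝ) :
    ∑ k ∈ Fibre3.outer1 L 2, φ k = ∑ k ∈ (Finset.univ : Finset (Tor L)).erase 0, φ k - ∑ k ∈ Fibre3.block1 L 2, φ k := by
  classical
  unfold Fibre3.outer1
  have h := Finset.sum_filter_add_sum_filter_not ((Finset.univ : Finset (Tor L)).erase 0) (fun k => k ∈ Fibre3.block1 L 2) φ
  have e : ((Finset.univ : Finset (Tor L)).erase 0).filter (fun k => k ∈ Fibre3.block1 L 2) = Fibre3.block1 L 2 := by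
    ext k
    simp only [Finset.mem_filter]
    constructor
    · exact fun h => h.2
    · exact fun hk => ⟨block1_subset_erase L hL hk, hk⟩
  rw [e] at h
  linarith

/-- power sums off the origin are the named sums (`g(0) = 0`). -/
theorem sum_erase_zero_gres_pow (j : ℕ) (hj : 1 ≤ j) :
    ∑ k ∈ (Finset.univ : Finset (Tor L)).erase 0, gres L lam2 k ^ j = ∑ k : Tor L, gres L lam2 k ^ j := by
  rw [Finset.sum_erase]
  have : gres L lam2 0 = 0 := by unfold gres; simp
  rw [this, zero_pow (by omega)]

/-- the first power sum off the origin. -/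
theorem sum_erase_zero_gres :
    ∑ k ∈ (Finset.univ : Finset (Tor L)).erase 0, gres L lam2 k = ∑ k : Tor L, gres L lam2 k := by
  rw [Finset.sum_erase]
  unfold gres; simp

/-! ## The scalar terms `S1h`, `kap` at the true vector -/

/-- `S1h ↦ θ²S₁` (`G̃(0) = S₁/V`, `u = c_sG̃(0)`). -/
theorem S1h_eval (hL : 5 ≤ L) (hΔ0 : 0 ≤ Δ) (hΔ1 : Δ < 1) (hf : IsGroundTwoMagnon L Δ lam2 f) (hlam : 0 < lam2)
    (hu : 0 < cS L Δ lam2 f * Gzero L lam2) :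
    S1h.eval (xTrue L Δ lam2 f (Δ * f (K1 L))) = (2 * Real.pi / L) ^ 2 * S1n L lam2 := by
  set X := xTrue L Δ lam2 f (Δ * f (K1 L)) with hXdef
  obtain ⟨_, dcs, duu, _, _⟩ := dict_at_xTrue L Δ lam2 f hL hΔ0 hΔ1 hf hlam
  have hLpos : (0 : ℝ) < L := by exact_mod_cast (show 0 < L by omega)
  have hX1 : X 1 = Real.pi ^ 2 := by rw [hXdef, xTrue_lt16 L Δ lam2 f _ (by norm_num)]; rfl
  have hG : Gzero L lam2 = S1n L lam2 / (L : ℝ) ^ 2 := gzeroNamed_holds L lam2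
  have hc : cS L Δ lam2 f ≠ 0 := by
    intro h; rw [h, zero_mul] at hu; exact lt_irrefl _ hu
  simp only [S1h, RExpr.eval, cst, vPi2]
  rw [dcs, duu, hX1, hG]; push_cast
  field_simp
  ring

/-- ★ `kap ↦ κ̂′ = κ̂ + 2ac_s/V` — the REPAIRED tail slope of `OuterMaj` (via `rho_epsStarR`; ground profile, `L ≥ 12`,
`2λ₂ < ε₁`, `c_sG̃(0) > 0`). -/
theorem kap_eval (hL : 12 ≤ L) (hΔ0 : 0 ≤ Δ) (hΔ1 : Δ < 1) (hf : IsGroundTwoMagnon L Δ lam2 f) (hlam : 0 < lam2)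
    (h2 : 2 * lam2 < eps1 L) (hu : 0 < cS L Δ lam2 f * Gzero L lam2) :
    kap.eval (xTrue L Δ lam2 f (Δ * f (K1 L)))
      = kapHat L Δ lam2 f 2 + 2 * aPar L Δ f * cS L Δ lam2 f / (L : ℝ) ^ 2 := by
  set X := xTrue L Δ lam2 f (Δ * f (K1 L)) with hXdef
  set θ : ℝ := 2 * Real.pi / L with hθdef
  obtain ⟨deps, dcs, duu, _, _⟩ := dict_at_xTrue L Δ lam2 f (by omega) hΔ0 hΔ1 hf hlam
  have hLpos : (0 : ℝ) < L := by exact_mod_cast (show 0 < L by omega)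
  have hπ := Real.pi_pos
  have hθ : 0 < θ := by positivity
  have hθ2 : θ ^ 2 ≠ 0 := by positivity
  have hX2 : X 2 = lam2 / θ ^ 2 := by rw [hXdef, xTrue_lt16 L Δ lam2 f _ (by norm_num)]; rfl
  have hX3 : X 3 = Δ * f (K1 L) := by rw [hXdef, xTrue_lt16 L Δ lam2 f _ (by norm_num)]; rfl
  have hP2 : L2.point L lam2 (Δ * f (K1 L)) 2 = X 2 := (xTrue_lt16 L Δ lam2 f _ (by norm_num)).symm
  have hP3 : L2.point L lam2 (Δ * f (K1 L)) 3 = X 3 := (xTrue_lt16 L Δ lam2 f _ (by norm_num)).symm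
  have hagree : ∀ i, i < 16 → L2.point L lam2 (Δ * f (K1 L)) i = X i := fun i hi => (xTrue_lt16 L Δ lam2 f _ hi).symm
  have heps : eps.eval (L2.point L lam2 (Δ * f (K1 L))) = eps.eval X :=
    eval_congr_below (n := 16) hagree eps (by simp [varsBelow, eps, vT, vPi2, cst])
  have huu' : uu.eval (L2.point L lam2 (Δ * f (K1 L))) = uu.eval X :=
    eval_congr_below (n := 16) hagree uu (by simp [varsBelow, uu, eps, vT, vPi2, vA, cst])
  have e17 := xTrue_17 L Δ lam2 f (Δ * f (K1 L))
  rw [hP2, hP3, heps, huu'] at e17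
  -- the energy floor `ε_m = 1 − cos 3θ > 2λ₂`
  set em : ℝ := 1 - Real.cos ((3 : ℕ) * θ) with hem
  have hθ3 : (3 : ℕ) * θ ≤ Real.pi := by
    rw [hθdef]; push_cast; rw [show (3 : ℝ) * (2 * Real.pi / L) = 6 * Real.pi / L by ring, div_le_iff₀ hLpos]
    have : (12 : ℝ) ≤ L := by exact_mod_cast hL
    nlinarith
  have hε1 : eps1 L ≤ em := by
    have h1 : Real.cos ((3 : ℕ) * θ) ≤ Real.cos θ :=
      Real.cos_le_cos_of_nonneg_of_le_pi hθ.le hθ3 (by push_cast; linarith)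
    unfold eps1; rw [hem, ← hθdef]
    linarith
  have hE : 2 * (lam2 / θ ^ 2) < em / θ ^ 2 := by
    rw [← mul_div_assoc, div_lt_div_iff_of_pos_right (by positivity)]; linarith
  -- `ρ(ε*) = ρ_M + aε/(2u)`
  have hk : 0 ≤ X 3 * eps.eval X * (3 * X 2 * uu.eval X)⁻¹ := by
    rw [hX3, deps, hX2, duu]
    have : 0 ≤ Δ * f (K1 L) := mul_nonneg hΔ0 (le_of_lt hf.1.2.2.1)
    positivity
  have hν0 : X 2 ≠ 0 := by rw [hX2]; positivity
  have hu0 : uu.eval X ≠ 0 := by rw [duu]; exact hu.ne'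
  have hrho := rho_epsStarR (ν := X 2) (a := X 3) (ε := eps.eval X) (u := uu.eval X) (E := em / θ ^ 2) hν0 hu0
    (by rw [hX2]; exact hE) hk
  -- evaluate `kap`
  have ekap : kap.eval X = 4 * cs.eval X * uu.eval X *
      ((2 * X 17 - X 2) * (2 * X 17 - 4 * X 2)⁻¹) := by
    simp only [kap, rho, RExpr.eval, cst, vEm, vNu]; push_cast; ring
  have e17' : X 17 = epsStarR (X 2) (X 3) (eps.eval X) (uu.eval X) (em / θ ^ 2) := e17
  rw [ekap, e17', hrho, dcs, duu, deps, hX2, hX3]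
  unfold kapHat rhoM aPar
  have hem' : 1 - Real.cos (2 * Real.pi * ((2 : ℕ) + 1) / L) = em := by
    rw [hem, hθdef]; push_cast; ring_nf
  rw [hem']
  have hden : 2 * em - 4 * lam2 ≠ 0 := by linarith
  have hden' : 2 * (em / θ ^ 2) - 4 * (lam2 / θ ^ 2) ≠ 0 := by
    rw [show 2 * (em / θ ^ 2) - 4 * (lam2 / θ ^ 2) = (2 * em - 4 * lam2) / θ ^ 2 by ring]
    exact div_ne_zero hden hθ2
  have hc0 : cS L Δ lam2 f ≠ 0 := fun h => by rw [h, zero_mul] at hu; exact lt_irrefl _ hu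
  have hG0 : Gzero L lam2 ≠ 0 := fun h => by rw [h, mul_zero] at hu; exact lt_irrefl _ hu
  field_simp
  ring

end Summit.HubbardSuperconductivity.HubbardSuperconductivity.Theorems.AnisotropyChord.Transfer.Fibre3.L2.N1
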